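import Summits.RiemannHypothesis.RiemannHypothesis.Theorems.Splittings.ScrewLatticeTowerB
import HarnessLib

/-!
# The rigid polygon TOWER, part C: vanishing of all moments, discreteness, the data theorem

Continuation of `ScrewLatticeTowerA`/`B` (K-task «TOWER», RULING #329; memo rh-idea-5 `TOWER-BARRIER.md` §1/§5).
THEOREMS: EVERY holomorphic moment `k ≥ 1` of the tower vanishes (`hasSum_moment`: `Σ_i wt_i · atom_i^k = 0`,
absolutely convergent — frequencies `k < K₀` see no gon, frequencies `k ≥ K₀` are killed by the step, part A
`moment_cancel`); below every radius `ρ < 1` only finitely many atoms (`finite_norm_le`); packaged, after scaling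
into the annulus `1 < ‖w‖ < R`, as `exists_towerData` — the clause list of the tree's
`ScrewWolffDiscreteData.exists_discreteWolffData` (incl. the unattained supremum of the moduli, from part B's
`exists_live_gt`).  ζ-free, RH-free; std axioms.  Nothing here bears on the truth of RH.
-/

set_option linter.dupNamespace false

namespace Summit.RiemannHypothesis.RiemannHypothesis.Theorems.Splittings.ScrewLatticeTower

open Complex Finset Filter Topology
open Summit.RiemannHypothesis.RiemannHypothesis.Theorems.Splittings.ScrewWolffDiscreteData (ω norm_ω sum_ω_pow)

noncomputable section

/-! ## 7. Vanishing of all moments -/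

/-- The `k`-th powers (`k ≥ 1`) of a live gon, summed with weights: `[n ∣ k] · term c n (x_n) k`. -/
theorem sum_gon_pow {c : ℝ} (hc : 0 < c) {K₀ : ℕ} (hK : 1 < c * K₀) (n : Live c K₀) {k : ℕ} (hk : 1 ≤ k) :
    ∑ l : Fin n.1, ((wt c K₀ (Sum.inr ⟨n, l⟩) : ℂ) * atom c K₀ (Sum.inr ⟨n, l⟩) ^ k)
      = if n.1 ∣ k then ((term c n.1 (res c K₀ n.1) k : ℝ) : ℂ) else 0 := by
  have h2 := le_of_res_ne_zero n.2
  have hK1 : 1 ≤ K₀ := by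
    by_contra h
    have : K₀ = 0 := by omega
    subst this; simp at hK; linarith
  have hn1 : 1 ≤ n.1 := le_trans hK1 h2
  have hn0 : n.1 ≠ 0 := by omega
  have hcn : 1 < c * n.1 := lt_of_lt_of_le hK (by gcongr)
  simp only [wt, atom]
  have : ∀ l : Fin n.1, ((|res c K₀ n.1| / ((n.1 : ℝ) * rad c n.1 ^ n.1) : ℝ) : ℂ) *
      ((rad c n.1 : ℂ) * rot n.1 (res c K₀ n.1) * ω n.1 ^ (l : ℕ)) ^ k
      = ((|res c K₀ n.1| / ((n.1 : ℝ) * rad c n.1 ^ n.1) : ℝ) : ℂ) * ((rad c n.1 : ℂ) ^ k *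
        rot n.1 (res c K₀ n.1) ^ k) * (ω n.1 ^ k) ^ (l : ℕ) := by
    intro l; ring
  rw [Finset.sum_congr rfl (fun l _ ↦ this l), ← Finset.mul_sum, sum_ω_pow hn0]
  split_ifs with hdvd
  · obtain ⟨m, hm⟩ := hdvd
    rw [hm, rot_pow hn1, term, Nat.mul_div_cancel_left m (Nat.pos_of_ne_zero hn0)]
    have hm1 : 1 ≤ m := by
      rcases Nat.eq_zero_or_pos m with h | h
      · subst h; rw [mul_zero] at hm; omega
      · exact h
    have hr : (rad c n.1 : ℂ) ≠ 0 := by exact_mod_cast (rad_pos hcn).ne'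
    have hnC : (n.1 : ℂ) ≠ 0 := by exact_mod_cast hn0
    have hsplit : (rad c n.1 : ℂ) ^ (n.1 * m) = (rad c n.1 : ℂ) ^ n.1 * (rad c n.1 : ℂ) ^ (n.1 * m - n.1) := by
      rw [← pow_add]; congr 1; rw [Nat.mul_comm]; exact (Nat.add_sub_cancel' (Nat.le_mul_of_pos_left n.1 hm1)).symm
    rw [hsplit]
    push_cast
    field_simp
  · simp

/-- The `k`-th powers of the seed vertices, summed with weights: the seed moment `[K₀ ∣ k] r_{K₀}^k`. -/
theorem sum_seed_pow {c : ℝ} {K₀ : ℕ} (hK1 : 1 ≤ K₀) (k : ℕ) :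
    ∑ l : Fin K₀, ((wt c K₀ (Sum.inl l) : ℂ) * atom c K₀ (Sum.inl l) ^ k)
      = ((seedMom c K₀ k : ℝ) : ℂ) := by
  have hK0 : K₀ ≠ 0 := by omega
  simp only [wt, atom]
  have : ∀ l : Fin K₀, (((1 / (K₀ : ℝ)) : ℝ) : ℂ) * ((rad c K₀ : ℂ) * ω K₀ ^ (l : ℕ)) ^ k
      = (((1 / (K₀ : ℝ)) : ℝ) : ℂ) * (rad c K₀ : ℂ) ^ k * (ω K₀ ^ k) ^ (l : ℕ) := by
    intro l; ring
  rw [Finset.sum_congr rfl (fun l _ ↦ this l), ← Finset.mul_sum, sum_ω_pow hK0, seedMom]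
  split_ifs with hdvd
  · have hKC : (K₀ : ℂ) ≠ 0 := by exact_mod_cast hK0
    push_cast
    field_simp
  · simp

/-- Summability of the moment family (dominated by the weights). -/
theorem summable_moment {c : ℝ} (hc : 0 < c) (hx : Real.exp (-(1 / c)) ≤ 1 / 18) {K₀ : ℕ}
    (hK : 2 ≤ c * K₀) (k : ℕ) : Summable (fun i : Idx c K₀ ↦ (wt c K₀ i : ℂ) * atom c K₀ i ^ k) := by
  have hK' : 1 < c * K₀ := by linarith
  have hK1 : 1 ≤ K₀ := by
    by_contra h
    have : K₀ = 0 := by omega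
    subst this; simp at hK; linarith
  refine Summable.of_norm_bounded (summable_wt hc hx hK) (fun i ↦ ?_)
  rw [norm_mul, norm_pow, Complex.norm_real, Real.norm_eq_abs, abs_of_pos (wt_pos hc hK' i), norm_atom hc hK']
  have hl : 1 < c * (level i) := lt_of_lt_of_le hK' (by gcongr; exact le_level i)
  have h1 : rad c (level i) ^ k ≤ 1 :=
    pow_le_one₀ (rad_pos hl).le (rad_lt_one hc (le_trans hK1 (le_level i))).le
  calc wt c K₀ i * rad c (level i) ^ k ≤ wt c K₀ i * 1 := by gcongr; exact (wt_pos hc hK' i).le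
    _ = wt c K₀ i := mul_one _

/-- **All holomorphic moments vanish**: `Σ_i wt_i · atom_i^k = 0` for every `k ≥ 1`. -/
theorem hasSum_moment {c : ℝ} (hc : 0 < c) (hx : Real.exp (-(1 / c)) ≤ 1 / 18) {K₀ : ℕ}
    (hK : 2 ≤ c * K₀) {k : ℕ} (hk : 1 ≤ k) :
    HasSum (fun i : Idx c K₀ ↦ (wt c K₀ i : ℂ) * atom c K₀ i ^ k) 0 := by
  have hK' : 1 < c * K₀ := by linarith
  have hK1 : 1 ≤ K₀ := by
    by_contra h
    have : K₀ = 0 := by omega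
    subst this; simp at hK; linarith
  -- seed part
  have hseed : HasSum ((fun i : Idx c K₀ ↦ (wt c K₀ i : ℂ) * atom c K₀ i ^ k) ∘ Sum.inl)
      ((seedMom c K₀ k : ℝ) : ℂ) := by
    rw [← sum_seed_pow hK1 k]
    exact hasSum_fintype _
  -- gon part, gon by gon
  set g : Live c K₀ → ℂ := fun n ↦ if n.1 ∣ k then ((term c n.1 (res c K₀ n.1) k : ℝ) : ℂ) else 0 with hg
  have hgon : ∀ n : Live c K₀, HasSum (fun l : Fin n.1 ↦
      ((fun i : Idx c K₀ ↦ (wt c K₀ i : ℂ) * atom c K₀ i ^ k) ∘ Sum.inr) ⟨n, l⟩) (g n) := by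
    intro n
    simp only [Function.comp, hg]
    rw [← sum_gon_pow hc hK' n hk]
    exact hasSum_fintype _
  -- the gon totals are supported on the live divisors of `k`
  set D : Finset (Live c K₀) := (Nat.divisors k).subtype (fun n ↦ res c K₀ n ≠ 0) with hD
  have hgsupp : ∀ n : Live c K₀, n ∉ D → g n = 0 := by
    intro n hn
    simp only [hg]
    rw [if_neg]
    intro hdvd
    apply hn
    rw [hD, Finset.mem_subtype]
    exact Nat.mem_divisors.2 ⟨hdvd, by omega⟩
  have hgsum : HasSum g (∑ n ∈ D, g n) := hasSum_sum_of_ne_finset_zero hgsupp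
  have hinr : HasSum ((fun i : Idx c K₀ ↦ (wt c K₀ i : ℂ) * atom c K₀ i ^ k) ∘ Sum.inr) (∑ n ∈ D, g n) :=
    HasSum.sigma_of_hasSum hgsum hgon ((summable_moment hc hx hK k).comp_injective Sum.inr_injective)
  have htot := HasSum.sum hseed hinr
  -- evaluate the total with `moment_cancel`
  suffices hzero : ((seedMom c K₀ k : ℝ) : ℂ) + ∑ n ∈ D, g n = 0 by rwa [hzero] at htot
  have hsum_eq : ∑ n ∈ D, g n
      = ((∑ d ∈ Nat.divisors k, (if K₀ ≤ d then term c d (res c K₀ d) k else 0) : ℝ) : ℂ) := by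
    rw [hD, Finset.sum_subtype_eq_sum_filter (f := fun d ↦
      if d ∣ k then ((term c d (res c K₀ d) k : ℝ) : ℂ) else 0)]
    push_cast
    rw [← Finset.sum_filter_add_sum_filter_not (Nat.divisors k) (fun d ↦ res c K₀ d ≠ 0)
      (fun d ↦ ((if K₀ ≤ d then term c d (res c K₀ d) k else 0 : ℝ) : ℂ))]
    have hdead : ∑ d ∈ (Nat.divisors k).filter (fun d ↦ ¬ res c K₀ d ≠ 0),
        ((if K₀ ≤ d then term c d (res c K₀ d) k else 0 : ℝ) : ℂ) = 0 := by
      refine Finset.sum_eq_zero fun d hd ↦ ?_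
      have : res c K₀ d = 0 := by simpa using (Finset.mem_filter.1 hd).2
      simp [this, term_zero]
    rw [hdead, add_zero]
    refine Finset.sum_congr rfl fun d hd ↦ ?_
    obtain ⟨hd1, hd2⟩ := Finset.mem_filter.1 hd
    rw [if_pos (Nat.dvd_of_mem_divisors hd1), if_pos (le_of_res_ne_zero hd2)]
  rw [hsum_eq]
  exact_mod_cast (show seedMom c K₀ k + _ = 0 from moment_cancel hk)

/-! ## 8. Discreteness inside the disc -/

/-- Below every radius `ρ < 1` there are only finitely many atoms. -/
theorem finite_norm_le {c : ℝ} (hc : 0 < c) {K₀ : ℕ} (hK : 1 < c * K₀) {ρ : ℝ} (hρ : ρ < 1) :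
    {i : Idx c K₀ | ‖atom c K₀ i‖ ≤ ρ}.Finite := by
  have hK1 : 1 ≤ K₀ := by
    by_contra h
    have : K₀ = 0 := by omega
    subst this; simp at hK; linarith
  obtain ⟨N, hNK, hN⟩ := exists_rad_gt hc hρ K₀
  -- atoms of level `n ≥ N` have norm `rad n ≥ rad N > ρ`
  have hbig : ∀ i : Idx c K₀, N ≤ level i → ρ < ‖atom c K₀ i‖ := by
    intro i hi
    rw [norm_atom hc hK]
    exact hN.trans_le (rad_le_rad hc (by omega) hi)
  rw [← Set.finite_preimage_inl_and_inr]
  constructor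
  · exact Set.toFinite _
  · have hinj : Set.InjOn (fun y : (Σ n : Live c K₀, Fin n.1) ↦ ((y.1.1 : ℕ), (y.2 : ℕ))) Set.univ := by
      rintro ⟨n, l⟩ _ ⟨n', l'⟩ _ h
      simp only [Prod.mk.injEq] at h
      obtain ⟨hn, hl⟩ := h
      have hnn : n = n' := Subtype.ext hn
      subst hnn
      have hll : l = l' := Fin.ext hl
      subst hll
      rfl
    refine ((Finset.range N ×ˢ Finset.range N).finite_toSet.preimage (hinj.mono (Set.subset_univ _))).subset ?_
    rintro ⟨n, l⟩ hy
    simp only [Set.mem_preimage, Set.mem_setOf_eq, Finset.coe_product, Set.mem_prod, Finset.coe_range,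
      Set.mem_Iio] at hy ⊢
    have hlev : n.1 < N := by
      by_contra hge
      exact absurd hy (not_le.mpr (hbig (Sum.inr ⟨n, l⟩) (by simpa [level] using not_lt.mp hge)))
    exact ⟨hlev, lt_trans l.2 hlev⟩

/-- Every atom is beaten in modulus by some other atom (a live gon of larger order, `exists_live_gt`). -/
theorem exists_norm_lt {c : ℝ} (hc : 0 < c) {K₀ : ℕ} (hK : 1 < c * K₀) (i : Idx c K₀) :
    ∃ j : Idx c K₀, ‖atom c K₀ i‖ < ‖atom c K₀ j‖ := by
  have hK1 : 1 ≤ K₀ := by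
    by_contra h
    have : K₀ = 0 := by omega
    subst this; simp at hK; linarith
  obtain ⟨n, hn, hlive⟩ := exists_live_gt hc hK (level i)
  have hKn : 1 ≤ n := le_trans hK1 (le_of_res_ne_zero hlive)
  refine ⟨Sum.inr ⟨⟨n, hlive⟩, ⟨0, hKn⟩⟩, ?_⟩
  rw [norm_atom hc hK, norm_atom hc hK]
  exact rad_lt_rad hc (le_trans hK1 (le_level i)) (by simpa [level] using hn)

/-! ## 9. The packaged data theorem -/

/-- **Tower data (B16-bis input).**  For every `R > 1` and every depth `c` with `0 < c` and `e^{-1/c} ≤ 1/18`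
(e.g. `c ≤ 1/3`, `exp_neg_inv_le`) the rigid polygon tower with a suitable seed order, scaled into the open
annulus `1 < ‖w‖ < R`, is a countable family of atoms with POSITIVE summable weights ALL of whose holomorphic
moments vanish, whose moduli have an unattained supremum (infinitely many live gons), DISCRETE in the annulus
(below every `ρ < R` only finitely many atoms) — the clause list of `ScrewWolffDiscreteData.exists_discreteWolffData`
(divisor rings), now realised by the polygon tower. -/
theorem exists_towerData {R : ℝ} (hR : 1 < R) {c : ℝ} (hc : 0 < c) (hx : Real.exp (-(1 / c)) ≤ 1 / 18) :
    ∃ (ι : Type) (_ : Countable ι) (w : ι → ℂ) (α : ι → ℝ),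
      Nonempty ι ∧ (∀ i, 1 < ‖w i‖ ∧ ‖w i‖ < R) ∧ (∀ i, 0 < α i) ∧ Summable α ∧
      (∀ k : ℕ, 1 ≤ k → HasSum (fun i ↦ (α i : ℂ) * w i ^ k) 0) ∧
      (∀ i, ∃ j, ‖w i‖ < ‖w j‖) ∧
      (∀ ρ < R, {i | ‖w i‖ ≤ ρ}.Finite) := by
  have hR0 : 0 < R := by linarith
  have hρ : 1 / R < 1 := by rw [div_lt_one hR0]; exact hR
  -- seed order: `c K₀ ≥ 2` and `r_{K₀} > 1/R`
  obtain ⟨N₁, _, hN₁⟩ := exists_rad_gt hc hρ 0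
  obtain ⟨K₀, hK₀⟩ := exists_nat_ge (max (N₁ : ℝ) (2 / c))
  have hKN : N₁ ≤ K₀ := by exact_mod_cast (le_max_left _ _).trans hK₀
  have hK2 : 2 ≤ c * K₀ := by
    have := (le_max_right _ _).trans hK₀
    rw [div_le_iff₀ hc] at this; linarith
  have hK' : 1 < c * K₀ := by linarith
  have hK1 : 1 ≤ K₀ := by
    by_contra h
    have : K₀ = 0 := by omega
    subst this; simp at hK2; linarith
  have hN1 : 1 ≤ N₁ := by
    by_contra h
    have : N₁ = 0 := by omega
    subst this
    simp [rad] at hN₁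
    have : 0 < 1 / R := by positivity
    linarith
  refine ⟨Idx c K₀, inferInstance, fun i ↦ (R : ℂ) * atom c K₀ i, wt c K₀, ⟨Sum.inl ⟨0, by omega⟩⟩, ?_,
    wt_pos hc hK', summable_wt hc hx hK2, ?_, ?_, ?_⟩
  · intro i
    rw [norm_mul, Complex.norm_real, Real.norm_eq_abs, abs_of_pos hR0, norm_atom hc hK']
    constructor
    · have h1 : rad c N₁ ≤ rad c (level i) := rad_le_rad hc hN1 (hKN.trans (le_level i))
      rw [div_lt_iff₀ hR0] at hN₁
      calc (1 : ℝ) < rad c N₁ * R := hN₁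
        _ ≤ rad c (level i) * R := by gcongr
        _ = R * rad c (level i) := mul_comm _ _
    · have hlt : rad c (level i) < 1 := rad_lt_one hc (le_trans hK1 (le_level i))
      calc R * rad c (level i) < R * 1 := by gcongr
        _ = R := mul_one R
  · intro k hk
    have h := (hasSum_moment hc hx hK2 hk).mul_left ((R : ℂ) ^ k)
    rw [mul_zero] at h
    have hfun : (fun i : Idx c K₀ ↦ ((wt c K₀ i : ℝ) : ℂ) * ((R : ℂ) * atom c K₀ i) ^ k)
        = fun i ↦ (R : ℂ) ^ k * ((wt c K₀ i : ℂ) * atom c K₀ i ^ k) := by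
      funext i; ring
    rw [hfun]
    exact h
  · intro i
    obtain ⟨j, hj⟩ := exists_norm_lt hc hK' i
    refine ⟨j, ?_⟩
    rw [norm_mul, norm_mul]
    gcongr
    rw [Complex.norm_real, Real.norm_eq_abs, abs_of_pos hR0]; exact hR0
  · intro ρ hρR
    have hρ' : ρ / R < 1 := by rw [div_lt_one hR0]; exact hρR
    refine (finite_norm_le hc hK' hρ').subset fun i hi ↦ ?_
    simp only [Set.mem_setOf_eq] at hi ⊢
    rw [norm_mul, Complex.norm_real, Real.norm_eq_abs, abs_of_pos hR0] at hi
    rw [le_div_iff₀ hR0]; linarith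

end

end Summit.RiemannHypothesis.RiemannHypothesis.Theorems.Splittings.ScrewLatticeTower
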